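import Summits.QuantumFields.BalabanUV.Beta.D1BFx.ProjectorSupNorm

/-!
# `BalabanUV.Beta.D1BFx.ProjectorMixedDiff` — road «BF-x» for binder row D1, slot (K), END row `hGrp gN`, letter «P-d2-MIXED» (an3-g57 §3′ (2):
# «the MIXED second difference `|δp_u(q+e_α) − δp_u(q)| ≤ k·n⁻⁶` (one difference per slot of `P = n⁻⁸·gq·C·gqᵀ` … by-name class, «P-d2-mixed», not stated)»;
# owner RULING ρ-g10-5 (a) «∇δp = «P-d2-mixed» `k n⁻⁶` via `BlockColumnSupNorm.abs_gq_diff_le_sup` on each factor»): THE PROJECTOR's MIXED SECOND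
# DIFFERENCE — ONE FORWARD DIFFERENCE IN EACH SLOT — IS `O(n⁻⁶)` WITH THE BLOCK DECAY, `|P(p+e_μ,q+e_ν) − P(p+e_μ,q) − P(p,q+e_ν) + P(p,q)| ≤ cPPs·(n+1)^{−(d+2)}·e^{−δ_PP|blk p − blk q|}`

HONEST DEPENDENCY (cell records, verbatim): «continuum YM on T⁴ ⇐ BetaPertH ∧ nine spine estimates (0/9 proved); BetaPertH ⇐ (D1) ∧ (D4) ∧
CAP+tail; G-an2-4 gates asym, D1 and NE2/3/4.»  HONEST FRAMING (cell contract, verbatim): «discharging `BetaPertH` makes Bałaban's UV stability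
UNCONDITIONAL — a real constructive-QFT result; it is NOT the continuum limit and NOT the Clay problem.»  THIS MODULE DISCHARGES NOTHING of the
wall: [folklore] — the proof of `ProjectorSupNorm.abs_Pker_diff_le_sup` VERBATIM with BOTH factors of `Pker = (n+1)^{−d}·Σ_y kerP(p,y)·gq(q,y)` differenced
(`ProjectorSupNorm.abs_kerP_diff_le_sup` × `BlockColumnSupNorm.abs_gq_diff_le_sup` through `BlockColumnSupNorm.abs_tsum_mul_le_of_decay`).  No `def`,
no `def … : Prop`, nothing cited, 0 sorry; hypothesis-free.  0 binders; (K) NOT closed; NOT D1, NOT `BetaPertH`, NOT continuum, NOT Clay.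
WHY: the dipole of the `dip` piece is `D = (ρ′−ρ)⊗p + ρ⊗(p−p′)` (`p = P(u,·)`, `p′ = P(u⁺,·)`); under `dSw` the factor `δp = p − p′` is differenced once
more, and the count of the `dip ⊗ dip` ∕ `dip ⊗ proj` cells (an3 §3′ (4) R2⊗R2, R1⊗R2: `[∇δp] = n⁻⁶`) needs the n⁻¹ of EACH of the two differences —
bounding `∇δp` by two first differences (`2·cPPs·n⁻⁵`) loses a power the cell cannot spare.
CONTENT.  `abs_Pker_diff_diff_le_sup` (general `d ≥ 3`, mesh `n+1`), `abs_Pgt_diff_diff_le_sup` (road currency `d = 4`, block side `n ≥ 1`: `≤ cPPs(4,a)·n⁻⁶·e^{−δ_PP dist}`).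
Unit `b2b-balaban-beta-d1-formalise-leaf-04` (gen 9), «GN-33∕KK» letters (journal 2026-08-21 ≈l.30555).
-/

namespace Summit.QuantumFields.BalabanUV.Beta.D1BFx.ProjectorMixedDiff

open Literature.MathematicalPhysics.QuantumFieldTheory.Balaban1983to89
open B4Sect5Proof (latticeConst latticeConst_nonneg)
open B6QGQLower276 (X e blk)
open B6QGQDecay237 (deltaU deltaU_pos)
open B5Hk103ScalarZd (gq)
open GhostLeg (cast_pred_add_one)
open RProjector (kerP Pker Pgt Pgt_apply deltaP deltaPP deltaP_pos deltaPP_pos summable_Pker)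
open ProjectorSupNorm (cPs cPPs cPs_nonneg abs_kerP_diff_le_sup)
open BlockColumnSupNorm (cG cG_pos abs_gq_diff_le_sup abs_tsum_mul_le_of_decay)

noncomputable section

variable {d : ℕ}

/-- [folklore] **«P-d2-MIXED»: ONE FORWARD DIFFERENCE IN EACH SLOT OF THE PROJECTOR COSTS `(n+1)⁻²`**:
`|P(p+e_μ,q+e_ν) − P(p+e_μ,q) − P(p,q+e_ν) + P(p,q)| ≤ cPPs(d,a)·((n+1)^{d+2})⁻¹·e^{−δ_PP|blk p − blk q|_∞}` — the mixed difference of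
`Pker = (n+1)^{−d}·Σ_y kerP(p,y)·gq(q,y)` is `(n+1)^{−d}·Σ_y (∇_μ kerP)(p,y)·(∇_ν gq)(q,y)`, each factor `O((n+1)⁻¹)` with its block decay. -/
theorem abs_Pker_diff_diff_le_sup (hd : 3 ≤ d) (n : ℕ) {a : ℝ} (ha : 0 < a) (p q : X d) (μ ν : Fin d) :
    |Pker n a (p + e μ) (q + e ν) - Pker n a (p + e μ) q - Pker n a p (q + e ν) + Pker n a p q|
      ≤ cPPs d a / ((n : ℝ) + 1) ^ (d + 2) * Real.exp (-(deltaPP d a * dist (blk n p) (blk n q))) := by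
  have hs : (0 : ℝ) < (n : ℝ) + 1 := by positivity
  have hN : (0 : ℝ) < ((n : ℝ) + 1) ^ d := by positivity
  have h1 := summable_Pker n ha (p + e μ) (q + e ν)
  have h2 := summable_Pker n ha (p + e μ) q
  have h3 := summable_Pker n ha p (q + e ν)
  have h4 := summable_Pker n ha p q
  have hsub : Pker n a (p + e μ) (q + e ν) - Pker n a (p + e μ) q - Pker n a p (q + e ν) + Pker n a p q
      = (((n : ℝ) + 1) ^ d)⁻¹ * ∑' y : X d, (kerP n a (p + e μ) y - kerP n a p y) * (gq n a (q + e ν) y - gq n a q y) := by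
    have e1 : ∑' y : X d, (kerP n a (p + e μ) y - kerP n a p y) * (gq n a (q + e ν) y - gq n a q y)
        = ((∑' y : X d, kerP n a (p + e μ) y * gq n a (q + e ν) y) - ∑' y : X d, kerP n a (p + e μ) y * gq n a q y)
          - ((∑' y : X d, kerP n a p y * gq n a (q + e ν) y) - ∑' y : X d, kerP n a p y * gq n a q y) := by
      rw [← h1.tsum_sub h2, ← h3.tsum_sub h4, ← (h1.sub h2).tsum_sub (h3.sub h4)]
      exact tsum_congr fun y => by ring
    rw [Pker, Pker, Pker, Pker, e1]
    ring
  have hK : 0 ≤ cPs d a / ((n : ℝ) + 1) := div_nonneg (cPs_nonneg d ha) hs.le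
  have hG : 0 ≤ cG d a / ((n : ℝ) + 1) := div_nonneg (cG_pos d ha).le hs.le
  have h := abs_tsum_mul_le_of_decay (deltaP_pos d ha) (deltaU_pos d ha) hK hG
    (blk n p) (blk n q) (fun y => abs_kerP_diff_le_sup hd n ha p y μ)
    (fun y => by rw [dist_comm]; exact abs_gq_diff_le_sup hd n ha q y ν)
  rw [hsub, abs_mul, abs_of_pos (inv_pos.2 hN)]
  calc (((n : ℝ) + 1) ^ d)⁻¹ * |∑' y : X d, (kerP n a (p + e μ) y - kerP n a p y) * (gq n a (q + e ν) y - gq n a q y)|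
      ≤ (((n : ℝ) + 1) ^ d)⁻¹ * (cPs d a / ((n : ℝ) + 1) * (cG d a / ((n : ℝ) + 1)) * latticeConst d (deltaU d a / 2)
          * Real.exp (-(min (deltaP d a) (deltaU d a) / 2 * dist (blk n p) (blk n q)))) :=
        mul_le_mul_of_nonneg_left h (inv_pos.2 hN).le
    _ = cPPs d a / ((n : ℝ) + 1) ^ (d + 2) * Real.exp (-(deltaPP d a * dist (blk n p) (blk n q))) := by
        rw [cPPs, deltaPP, pow_succ, pow_succ]
        field_simp

/-- [folklore] **«P-d2-MIXED» IN THE ROAD's CURRENCY** (`d = 4`, blocks of side `n ≥ 1`):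
`|Pgt n a (x+e_μ) (y+e_ν) − Pgt n a (x+e_μ) y − Pgt n a x (y+e_ν) + Pgt n a x y| ≤ cPPs(4,a)·n⁻⁶·e^{−δ_PP(4,a)|blk x − blk y|_∞}` (every fibre index). -/
theorem abs_Pgt_diff_diff_le_sup (n : ℕ) [NeZero n] {a : ℝ} (ha : 0 < a) (x y : X 4) (μ ν : Fin 4) (u v : Unit) :
    |Pgt n a (x + e μ) (y + e ν) u v - Pgt n a (x + e μ) y u v - Pgt n a x (y + e ν) u v + Pgt n a x y u v|
      ≤ cPPs 4 a / (n : ℝ) ^ 6 * Real.exp (-(deltaPP 4 a * dist (blk (n - 1) x) (blk (n - 1) y))) := by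
  have h := abs_Pker_diff_diff_le_sup (d := 4) (by norm_num) (n - 1) ha x y μ ν
  rw [cast_pred_add_one n] at h
  rw [Pgt_apply, Pgt_apply, Pgt_apply, Pgt_apply]; exact h

end

end Summit.QuantumFields.BalabanUV.Beta.D1BFx.ProjectorMixedDiff
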